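import Summits.ABC.IUTFork.Joshi.TensorNorms
import Literature.Analysis.OperatorTheory.ProjectiveTensorNormCross
import HarnessLib

/-!
# Joshi's §7.6, part 3 (arXiv:2401.13508 v4, Thm 7.6.2.2, PDF p. 62 l. 3–16): the cross-norm property of BOTH tensor norms
# reduced to the bidual (norming-functional) hypothesis, citing the tree's `Literature.Analysis.OperatorTheory` by name

Record file of the abc-iut cell, branch E (rung LADDER-ABC:A2.E; seat abc-iut-E-t14, slot T-14). Companion of
`Joshi/TensorNorms.lean` (p429229) and `Joshi/AdelicSizes.lean` (p429241); source / bib (`Joshi2024ATS3`) / framing as there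
(UNREFEREED preprint, disputed in print [Mochizuki2024JoshiReport]; typed ≠ proved ≠ endorsed; no side taken; nothing here
asserts abc or [IUTchIII] Cor. 3.12).

RECONCILIATION. The archimedean cross-norm identity `‖⨂ₜ[𝕜] i, m i‖ = ∏ ‖m i‖` (Thm 7.6.2.2 (1), projective half) is the
tree's `Literature.Analysis.OperatorTheory.norm_tprod_eq_prod_norm_rclike` (abc-iut-found, p428374, [Ryan 2002, Prop. 2.1]);
`TensorNorm.norm_tprod` of part 1 is the same statement proved independently — CITE THE LITERATURE DECL. What this part adds,
using the Literature mechanism `prod_norm_le_of_dual_bound` (any quantity obeying the dual bound dominates `∏ ‖m i‖` as soon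
as each `m i` is normed by the dual, `‖ι (m i)‖ = ‖m i‖`, `ι = NormedSpace.inclusionInDoubleDual`):

* `injectiveNorm_tprod_of_bidual` — over ANY nontrivially normed field, the INJECTIVE norm of part 1 is cross on every pure
  tensor whose factors are normed by their duals; `hasCrossNorm_injectiveNorm_of_bidual`, `hasCrossNorm_norm_of_bidual`
  (the projective one = Literature `norm_tprod_eq_prod_norm`, restated in part 1's `HasCrossNorm` vocabulary).
* `crossNormClaim_of_bidual`, `crossNormSeminormedClaim_of_bidual`, `injectiveNorm_eq_norm_tprod_of_bidual` — Joshi's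
  p-adic hypotheses Thm 7.6.2.2 (3) (both forms) FOLLOW from «every (semi)normed space over `E` is normed by its dual», which
  over a spherically complete `E` (every p-adic field: `Literature.Analysis.OperatorTheory.IsSphericallyComplete`, abc-iut-found
  p429154) is Ingleton's non-archimedean Hahn–Banach theorem — NOT in the tree or Mathlib (plan/E FOUNDATIONS §G row G19); so
  this file LOCATES exactly what (3) needs and asserts nothing. (Mathlib's operator norm is the least bound, i.e.
  `‖ι x‖ = sup_g ‖g x‖ / ‖g‖`, the ratio form that Ingleton's theorem makes equal to `‖x‖`; the unit-ball supremum may be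
  smaller over a non-archimedean field and is not used.) Thm 7.6.2.2 (2) (projective = injective) is NOT reduced here: it
  needs the orthogonal-basis structure theory over spherically complete fields [van der Put–van Tiel 1967], absent as well.

No definitions, instances, notation or axioms; theorems only.
-/

noncomputable section

open scoped TensorProduct
open PiTensorProduct

universe u v w

namespace Summit.ABC.IUTFork.Joshi.TensorNorm

section Bidual

variable {ι : Type*} [Fintype ι] {𝕜 : Type*} [NontriviallyNormedField 𝕜]
  {V : ι → Type*} [∀ i, SeminormedAddCommGroup (V i)] [∀ i, NormedSpace 𝕜 (V i)]

/-- The injective norm obeys the dual bound on pure tensors: `∏ ‖f i (m i)‖ ≤ injectiveNorm (⨂ₜ m) · ∏ ‖f i‖` for every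
family of functionals `f` (from `ratio_le_injectiveNorm`; the degenerate case `∏ ‖f i‖ = 0` forces `∏ ‖f i (m i)‖ = 0`). -/
theorem prod_norm_apply_le_injectiveNorm_mul (m : Π i, V i) (f : Π i, V i →L[𝕜] 𝕜) :
    ∏ i, ‖f i (m i)‖ ≤ injectiveNorm (⨂ₜ[𝕜] i, m i) * ∏ i, ‖f i‖ := by
  have hr := ratio_le_injectiveNorm f (⨂ₜ[𝕜] i, m i)
  rw [dualEval_tprod, norm_prod] at hr
  rcases (Finset.prod_nonneg fun i (_ : i ∈ Finset.univ) => norm_nonneg (f i)).eq_or_lt with h0 | hpos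
  · obtain ⟨i, -, hi⟩ := Finset.prod_eq_zero_iff.mp h0.symm
    have hfi : ‖f i (m i)‖ = 0 :=
      le_antisymm (((f i).le_opNorm (m i)).trans (by rw [hi, zero_mul])) (norm_nonneg _)
    rw [Finset.prod_eq_zero (Finset.mem_univ i) hfi, ← h0, mul_zero]
  · exact (div_le_iff₀ hpos).mp hr

/-- **Injective cross-norm under the bidual hypothesis (any field).** If every factor `m i` is normed by its dual unit ball in
the operator-norm sense (`‖ι (m i)‖ = ‖m i‖`), then `injectiveNorm (⨂ₜ m) = ∏ ‖m i‖` — via the Literature mechanism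
`Literature.Analysis.OperatorTheory.prod_norm_le_of_dual_bound` [Ryan 2002, Prop. 2.1]. Over `ℝ`, `ℂ` the hypothesis is
Hahn–Banach (part 1's `injectiveNorm_tprod`); over a p-adic field it is Ingleton's theorem (not in the tree). -/
theorem injectiveNorm_tprod_of_bidual (m : Π i, V i)
    (h : ∀ i, ‖NormedSpace.inclusionInDoubleDual 𝕜 (V i) (m i)‖ = ‖m i‖) :
    injectiveNorm (⨂ₜ[𝕜] i, m i) = ∏ i, ‖m i‖ :=
  le_antisymm (injectiveNorm_tprod_le m)
    (Literature.Analysis.OperatorTheory.prod_norm_le_of_dual_bound m h (injectiveNorm_nonneg _)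
      (prod_norm_apply_le_injectiveNorm_mul m))

/-- The injective norm is cross (part 1's `HasCrossNorm`) as soon as all the spaces `V i` are normed by their duals. -/
theorem hasCrossNorm_injectiveNorm_of_bidual
    (h : ∀ i (x : V i), ‖NormedSpace.inclusionInDoubleDual 𝕜 (V i) x‖ = ‖x‖) :
    HasCrossNorm (injectiveNorm (𝕜 := 𝕜) (V := V)) :=
  fun m => injectiveNorm_tprod_of_bidual m fun i => h i (m i)

/-- The projective norm is cross as soon as all the spaces `V i` are normed by their duals — this IS the tree's
`Literature.Analysis.OperatorTheory.norm_tprod_eq_prod_norm` (abc-iut-found p428374), in `HasCrossNorm` form. -/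
theorem hasCrossNorm_norm_of_bidual
    (h : ∀ i (x : V i), ‖NormedSpace.inclusionInDoubleDual 𝕜 (V i) x‖ = ‖x‖) :
    HasCrossNorm (fun x : ⨂[𝕜] i, V i => ‖x‖) :=
  fun m => Literature.Analysis.OperatorTheory.norm_tprod_eq_prod_norm m fun i => h i (m i)

/-- Under the bidual hypothesis both tensor norms agree ON PURE TENSORS (`injectiveNorm (⨂ₜ m) = ‖⨂ₜ m‖ = ∏ ‖m i‖`); Joshi's
Thm 7.6.2.2 (2) asserts agreement on ALL tensors over a p-adic field, which is not derived here. -/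
theorem injectiveNorm_eq_norm_tprod_of_bidual (m : Π i, V i)
    (h : ∀ i, ‖NormedSpace.inclusionInDoubleDual 𝕜 (V i) (m i)‖ = ‖m i‖) :
    injectiveNorm (⨂ₜ[𝕜] i, m i) = ‖(⨂ₜ[𝕜] i, m i)‖ := by
  rw [injectiveNorm_tprod_of_bidual m h, Literature.Analysis.OperatorTheory.norm_tprod_eq_prod_norm m h]

end Bidual

/-! ## Joshi's p-adic hypotheses Thm 7.6.2.2 (3) located: they follow from «spaces over `E` are normed by their duals» -/

section PadicReduction

variable {p : ℕ} [Fact p.Prime] {E : Type u} [NontriviallyNormedField E] [NormedAlgebra ℚ_[p] E]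

/-- **Thm 7.6.2.2 (3) ⇐ norming functionals.** If every Banach space over the p-adic field `E` is normed by its dual in the
operator-norm sense (Ingleton's Hahn–Banach for spherically complete fields — absent from the tree; FOUNDATIONS §G G19),
then Joshi's `CrossNormClaim p E` holds, by `Literature.Analysis.OperatorTheory.norm_tprod_eq_prod_norm`. -/
theorem crossNormClaim_of_bidual
    (h : ∀ (W : Type w) [NormedAddCommGroup W] [NormedSpace E W], CompleteSpace W →
      ∀ x : W, ‖NormedSpace.inclusionInDoubleDual E W x‖ = ‖x‖) :
    CrossNormClaim.{u, v, w} p E :=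
  fun _ _ _ V _ _ hc m =>
    Literature.Analysis.OperatorTheory.norm_tprod_eq_prod_norm m fun i => h (V i) (hc i) (m i)

/-- The completeness-free form likewise, from the same hypothesis on all seminormed `E`-spaces. -/
theorem crossNormSeminormedClaim_of_bidual
    (h : ∀ (W : Type w) [SeminormedAddCommGroup W] [NormedSpace E W],
      ∀ x : W, ‖NormedSpace.inclusionInDoubleDual E W x‖ = ‖x‖) :
    CrossNormSeminormedClaim.{u, v, w} p E :=
  fun _ _ _ V _ _ m =>
    Literature.Analysis.OperatorTheory.norm_tprod_eq_prod_norm m fun i => h (V i) (m i)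

/-- … and under the same hypothesis the INJECTIVE norm of part 1 is cross on Banach families over `E` as well (the
injective half of what Thm 7.6.2.2 (2)+(3) assert together). -/
theorem injectiveNorm_tprod_of_bidual_padic
    (h : ∀ (W : Type w) [NormedAddCommGroup W] [NormedSpace E W], CompleteSpace W →
      ∀ x : W, ‖NormedSpace.inclusionInDoubleDual E W x‖ = ‖x‖)
    {ι : Type v} [Fintype ι] (V : ι → Type w) [∀ i, NormedAddCommGroup (V i)] [∀ i, NormedSpace E (V i)]
    (hc : ∀ i, CompleteSpace (V i)) (m : Π i, V i) :
    injectiveNorm (⨂ₜ[E] i, m i) = ∏ i, ‖m i‖ :=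
  injectiveNorm_tprod_of_bidual m fun i => h (V i) (hc i) (m i)

end PadicReduction

end Summit.ABC.IUTFork.Joshi.TensorNorm

end
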